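import Summits.ResolutionOfSingularities.ResolutionOfSingularities.Theorems.FrobeniusLadderFRationalResolutionLocalizationQuotientTransport
import Mathlib.RingTheory.KrullDimension.Basic
import HarnessLib

/-!
# Crux `FrobeniusLadder.FRationalResolution` (stmt-ResolutionOfSingularities-15317), line `redirect`,
# stub `stub_diagonalizableQuotientResolution` — the ring isomorphism `R_𝔮 ⧸ J' R_𝔮 ≅ (R_M/J)_{q₀/J}`
# itself, and the equality of Krull dimensions (for Kato's condition (2.1)(ii) on the invariant
# neighbourhood; memo MEMO-15317-leafhand2-g3 §6–§7, step (f))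

`…LocalizationQuotientTransport` transported regularity along `R_𝔮 ⧸ J'R_𝔮 ≅ (R_M)_{q₀} ⧸ J ≅ (R_M/J)_{q₀/J}`
(`R_M` a localization of `R`, `J ≤ q₀`, `𝔮 = q₀ ∩ R`, `J' = J ∩ R`). The dimension count of Kato's
(2.1)(ii) needs the same identification for `ringKrullDim`; this file records the isomorphism as a
`Nonempty` statement (no definitions) and the dimension equality.

* `nonempty_ringEquiv_atPrime_quotient` — `Nonempty (R_𝔮 ⧸ J'R_𝔮 ≃+* (R_M ⧸ J)_{q₀/J})`;
* `ringKrullDim_atPrime_quotient_eq` — equality of Krull dimensions of the two local rings.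

Honest label: plumbing brick (no stub closed). No definitions, no named facts, no sorry. [folklore]
-/

noncomputable section

-- single-problem summit: the doubled namespace component is forced
set_option linter.dupNamespace false

open Literature.AlgebraicGeometry.Resolution

namespace Summit.ResolutionOfSingularities.ResolutionOfSingularities.Theorems.FRationalResolution.LocalizationQuotientEquiv

universe u

variable {R : Type u} [CommRing R] (M : Submonoid R)

/-- **`R_𝔮 ⧸ J'R_𝔮 ≅ (R_M/J)_{q₀/J}`** for a localization `R_M = Localization M`, an ideal `J ≤ q₀`
(prime) of `R_M`, `𝔮 = q₀ ∩ R`, `J' = J ∩ R`. [folklore] -/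
theorem nonempty_ringEquiv_atPrime_quotient (J q₀ : Ideal (Localization M)) [q₀.IsPrime]
    (hJq : J ≤ q₀) :
    haveI : (q₀.map (Ideal.Quotient.mk J)).IsPrime := Ideal.isPrime_map_quotientMk_of_isPrime hJq
    Nonempty ((Localization.AtPrime (q₀.comap (algebraMap R (Localization M))) ⧸
      (J.comap (algebraMap R (Localization M))).map
        (algebraMap R (Localization.AtPrime (q₀.comap (algebraMap R (Localization M)))))) ≃+*
      Localization.AtPrime (q₀.map (Ideal.Quotient.mk J))) := by
  haveI : (q₀.map (Ideal.Quotient.mk J)).IsPrime := Ideal.isPrime_map_quotientMk_of_isPrime hJq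
  set 𝔮 : Ideal R := q₀.comap (algebraMap R (Localization M)) with h𝔮
  set J' : Ideal R := J.comap (algebraMap R (Localization M)) with hJ'
  -- `R_𝔮 ≅ (R_M)_{q₀}` over `R`
  let T := Localization.AtPrime q₀
  haveI : IsLocalization.AtPrime T 𝔮 :=
    IsLocalization.isLocalization_atPrime_localization_atPrime M q₀
  let ψ : Localization.AtPrime 𝔮 ≃ₐ[R] T := IsLocalization.algEquiv 𝔮.primeCompl _ _
  have hJ : J = J'.map (algebraMap R (Localization M)) :=
    (IsLocalization.map_under (M := M) (Localization M) J).symm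
  have hideal : J.map (algebraMap (Localization M) T) =
      (J'.map (algebraMap R (Localization.AtPrime 𝔮))).map (ψ : Localization.AtPrime 𝔮 →+* T) := by
    rw [hJ, Ideal.map_map, Ideal.map_map, ← IsScalarTower.algebraMap_eq]
    congr 1
    ext r
    simp
  -- quotients
  let θ₁ := Ideal.quotientEquiv (J'.map (algebraMap R (Localization.AtPrime 𝔮)))
    (J.map (algebraMap (Localization M) T)) (ψ : Localization.AtPrime 𝔮 ≃+* T) (by
      rw [hideal]; rfl)
  -- `(R_M)_{q₀} ⧸ J ≅ (R_M ⧸ J)_{q₀/J}`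
  haveI := isLocalization_atPrime_localization_quotient J q₀ hJq
  let θ₂ := (IsLocalization.algEquiv (q₀.map (Ideal.Quotient.mk J)).primeCompl
    (Localization.AtPrime (q₀.map (Ideal.Quotient.mk J)))
    (Localization.AtPrime q₀ ⧸ J.map (algebraMap (Localization M) (Localization.AtPrime q₀)))).toRingEquiv
  exact ⟨θ₁.trans θ₂.symm⟩

/-- Hence the two local rings have the same Krull dimension. [folklore] -/
theorem ringKrullDim_atPrime_quotient_eq (J q₀ : Ideal (Localization M)) [q₀.IsPrime]
    (hJq : J ≤ q₀) :
    haveI : (q₀.map (Ideal.Quotient.mk J)).IsPrime := Ideal.isPrime_map_quotientMk_of_isPrime hJq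
    ringKrullDim (Localization.AtPrime (q₀.comap (algebraMap R (Localization M))) ⧸
      (J.comap (algebraMap R (Localization M))).map
        (algebraMap R (Localization.AtPrime (q₀.comap (algebraMap R (Localization M)))))) =
      ringKrullDim (Localization.AtPrime (q₀.map (Ideal.Quotient.mk J))) := by
  obtain ⟨e⟩ := nonempty_ringEquiv_atPrime_quotient M J q₀ hJq
  exact ringKrullDim_eq_of_ringEquiv e

end Summit.ResolutionOfSingularities.ResolutionOfSingularities.Theorems.FRationalResolution.LocalizationQuotientEquiv

end
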